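import Summits.Ventures.QEC.Census.CertCheckBZMitmLemmas
import HarnessLib

/-!
# Soundness of the meet-in-the-middle replay, II: the enumeration verdict `henum` of `bz_block`

`henum_of_mitm`: if the allow-list decomposes (`foundOK`), the matrix is systematic with rows `< 2^n`
(`matrixSysOK`, in the tree as the `bzZSys` facts) and EVERY PART of the meet-in-the-middle replay
(`mitmPart`, `Census/CertCheckBZMitm.lean`) passes at threshold `wmax`, then every selection `a` with
`1 ≤ |a| ≤ t` whose codeword has weight `≤ wmax` gives a stabilizer codeword — VERBATIM the conclusion and the
remaining hypotheses of `CertCheckBZBridge.henum_of_matrixOK` (type-10), so it plugs into `bz_block` unchanged.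
Layers `|a| ≤ 3` are met by the direct parts; layers 4 and 5 by the pigeonhole of part I (`exists_group_miss`) + (T1)
on the pair of the two smallest rows + (T3) on the probe of the remaining rows, whose leaf test is the leaf test of
the whole codeword.

Tier KERNEL (axioms standard); no distance value is asserted. qec-search-9 (g2); reuses the word lemmas of
`Census/CertMitmLemmas.lean` (qec-type-07 g3), `Census/CertSystematicWeight.lean` and `Census/CertMitmLayers.lean`
(qec-type-11 / qec-type-01), and the byte-parallel popcount of `Census/CertPopcount.lean` (qec-search-10 / qec-type-10).
-/

namespace Summit.Ventures.QEC.Census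

/-! ## Soundness, part 3: the enumeration verdict (`henum` of `bz_block`) from the meet-in-the-middle parts -/

section Main

open List Matrix Finset Literature.InformationTheory.QuantumCodes

variable {n : ℕ}

/-- `Nat.blt` unpacked (local copy of a one-liner; private to avoid a cross-library import). -/
private theorem lt_of_blt {a b : ℕ} (h : Nat.blt a b = true) : a < b := by simpa [Nat.blt_eq] using h

/-- The support rows form a sublist of the indexed rows. -/
theorem suppRows_sublist (G : List ℕ) (a : Fin G.length → ZMod 2) : ((suppIdx G.length a).map fun j => (j, G.getD j 0)) <+ idxRows G 0 := by
  have h1 : ((suppIdx G.length a).map fun j => (j, G.getD j 0)) =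
      ((List.finRange G.length).filter fun j => decide (a j ≠ 0)).map ((fun j : ℕ => (j, G.getD j 0)) ∘ Fin.val) := by
    simp [suppIdx, List.map_map]
  have h2 : idxRows G 0 = (List.finRange G.length).map ((fun j : ℕ => (j, G.getD j 0)) ∘ Fin.val) := by
    rw [idxRows_zero, ← List.map_map, List.map_coe_finRange_eq_range]
  rw [h1, h2]
  apply List.Sublist.map
  apply List.filter_sublist

/-- Their number is the Hamming weight of `a`. -/
theorem length_suppRows (G : List ℕ) (a : Fin G.length → ZMod 2) :
    ((suppIdx G.length a).map fun j => (j, G.getD j 0)).length = hammingNorm a := by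
  have := length_rowSupp G a
  rw [rowSupp, List.length_map] at this
  rw [List.length_map, this]

/-- Their XOR is the codeword of the support list. -/
theorem xorList_suppRows (G : List ℕ) (a : Fin G.length → ZMod 2) :
    xorList (((suppIdx G.length a).map fun j => (j, G.getD j 0)).map Prod.snd) = xorSnd (rowSupp G a) := by
  simp only [rowSupp, xorSnd, List.map_map]
  rfl

/-- Each support row is `(j, G[j])` with `j < |G|`. -/
theorem suppRows_spec (G : List ℕ) (a : Fin G.length → ZMod 2) :
    ∀ e ∈ ((suppIdx G.length a).map fun j => (j, G.getD j 0)), e.1 < G.length ∧ e.2 = G.getD e.1 0 := by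
  intro e he
  simp only [List.mem_map] at he
  obtain ⟨j, hj, rfl⟩ := he
  exact ⟨lt_of_mem_suppIdx _ a hj, rfl⟩

/-- The support row indices are distinct. -/
theorem nodup_suppRows_fst (G : List ℕ) (a : Fin G.length → ZMod 2) :
    (((suppIdx G.length a).map fun j => (j, G.getD j 0)).map Prod.fst).Nodup := by
  have : ((suppIdx G.length a).map fun j => (j, G.getD j 0)).map Prod.fst = suppIdx G.length a := by
    simp [List.map_map, Function.comp_def]
  rw [this]
  exact nodup_suppIdx _ a

/-- A row word of a matrix whose rows are below `2^n`. -/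
theorem getD_lt_of_all_lt {G : List ℕ} (hlt : ∀ g ∈ G, g < 2 ^ n) {j : ℕ} (hj : j < G.length) :
    G.getD j 0 < 2 ^ n := by
  rw [List.getD_eq_getElem?_getD, List.getElem?_eq_getElem hj, Option.getD_some]
  exact hlt _ (List.getElem_mem hj)

/-- One `mitmLayerOK` part unpacked at a given group: (T1) and the layer's probes. -/
theorem layer_of_part {W : ℕ} {allow Gb : List ℕ} {mt : BZMatrix} {w g : ℕ}
    (hw : w = 4 ∨ w = 5) (hg : g < W + 1 - w) (ht : w ≤ mt.t)
    (hm : ∀ p, p < mitmParts W → mitmPart n W allow Gb mt p = true) :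
    t1OK (groupMask n mt.T (W + 1 - w) g) n
        (buildTabs (groupMask n mt.T (W + 1 - w) g) n (pairXT (idxRows (giRows Gb mt) 0)) 0 ([], 0))
        (pairXT (idxRows (giRows Gb mt) 0)) 0 = true ∧
      probesOK ((n + 7) / 8) W allow (groupMask n mt.T (W + 1 - w) g) n
        (buildTabs (groupMask n mt.T (W + 1 - w) g) n (pairXT (idxRows (giRows Gb mt) 0)) 0 ([], 0))
        (idxRows (giRows Gb mt) 0) w = true := by
  rcases hw with rfl | rfl
  · have h := hm (2 + g) (by simp only [mitmParts]; omega)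
    rw [mitmPart, if_neg (by omega), if_neg (by omega), if_pos (by omega), Bool.or_eq_true] at h
    rcases h with h | h
    · have := lt_of_blt h
      omega
    · rw [show 2 + g - 2 = g by omega, mitmLayerOK] at h
      simpa [Bool.and_eq_true] using h
  · have h := hm (2 + (W + 1 - 4) + g) (by simp only [mitmParts]; omega)
    rw [mitmPart, if_neg (by omega), if_neg (by omega), if_neg (by omega), if_pos (by omega), Bool.or_eq_true] at h
    rcases h with h | h
    · have := lt_of_blt h
      omega
    · rw [show 2 + (W + 1 - 4) + g - 2 - (W + 1 - 4) = g by omega, mitmLayerOK] at h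
      simpa [Bool.and_eq_true] using h

/-- **C4 ⇒ the enumeration verdict, by meet in the middle** (hypothesis `henum` of `bz_block`, same statement as
`CertCheckBZBridge.henum_of_matrixOK`): if the allow-list decomposes over the stabilizer rows, the matrix `G_i`
is systematic on `T_i` with rows `< 2^n` (`matrixSysOK`), and EVERY part of the meet-in-the-middle replay at
threshold `wmax` passes, then every selection `a` with `1 ≤ |a| ≤ t_i` whose codeword `Σ a_j G_i[j]` has weight
`≤ wmax` gives a STABILIZER codeword.  Layers `|a| ≤ 3`: the codeword is met by the direct parts; layers 4, 5: the
codeword has its `|a|` pivot bits on the `T`-columns and so at most `wmax − |a|` bits on the redundancy columns,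
hence misses one of the `wmax + 1 − |a|` disjoint redundancy-column groups (`exists_group_miss`); on that group the
key of the two smallest rows' pair equals the key of the remaining rows' XOR, (T1) puts the pair in that bucket and
the probe's (T3) test is exactly the leaf test of the whole codeword. -/
theorem henum_of_mitm {wmax : ℕ} {found : List (ℕ × List ℕ)} {Hstab Gb : List ℕ} {mt : BZMatrix}
    (hfound : foundOK Hstab found = true) (hsys : matrixSysOK n Gb mt = true)
    (hm : ∀ p, p < mitmParts wmax → mitmPart n wmax (found.map Prod.fst) Gb mt p = true)
    {kb : ℕ} (hk : (giRows Gb mt).length = kb) (a : Fin kb → ZMod 2) (ha1 : 1 ≤ hammingNorm a)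
    (hat : hammingNorm a ≤ mt.t) (haw : hammingNorm (∑ j, a j • rowFun n (giRows Gb mt) kb j) ≤ wmax) :
    (∑ j, a j • rowFun n (giRows Gb mt) kb j) ∈ rowSpace (rowMatrix n Hstab) := by
  subst hk
  set allow := found.map Prod.fst with hallow
  set B := (n + 7) / 8 with hBdef
  -- systematic-form facts
  simp only [matrixSysOK, Bool.and_eq_true, List.all_eq_true, decide_eq_true_eq] at hsys
  obtain ⟨hsysT, hlt⟩ := hsys
  obtain ⟨hlenT, hTlt, -⟩ := systematicOK_spec hsysT
  -- the direct part
  have h0 := hm 0 (by simp only [mitmParts]; omega)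
  rw [mitmPart, if_pos rfl, mitmDirectOK] at h0
  simp only [Bool.and_eq_true, List.all_eq_true] at h0
  obtain ⟨⟨⟨⟨⟨⟨ht5, hnB⟩, hB31⟩, hd1⟩, hd2⟩, hg4⟩, hg5⟩ := h0
  have ht5' : mt.t ≤ 5 := Nat.le_of_ble_eq_true ht5
  have hnB' : n ≤ 8 * B := Nat.le_of_ble_eq_true hnB
  have hB31' : B ≤ 31 := Nat.le_of_ble_eq_true hB31
  -- the support rows and the codeword
  set S := (suppIdx (giRows Gb mt).length a).map (fun j => (j, (giRows Gb mt).getD j 0)) with hSdef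
  have hSsub : S <+ idxRows (giRows Gb mt) 0 := suppRows_sublist (giRows Gb mt) a
  have hSlen : S.length = hammingNorm a := length_suppRows (giRows Gb mt) a
  have hSspec : ∀ e ∈ S, e.1 < mt.T.length ∧ e.2 = (giRows Gb mt).getD e.1 0 := fun e he => by
    have := suppRows_spec (giRows Gb mt) a e he
    rw [← hlenT]
    exact this
  have hSnd : (S.map Prod.fst).Nodup := nodup_suppRows_fst (giRows Gb mt) a
  have hSpw : S.Pairwise (fun p q => p.1 < q.1) := (pairwise_idxRows_zero (giRows Gb mt)).sublist hSsub
  set c := xorList (S.map Prod.snd) with hcdef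
  have hsum : ∑ j, a j • rowFun n (giRows Gb mt) (giRows Gb mt).length j = ofBits n c := by
    rw [hcdef, hSdef, xorList_suppRows, ofBits_xorSnd_rowSupp, ← sum_smul_rowMatrix_eq_vecMul]
    refine Finset.sum_congr rfl fun j _ => ?_
    congr 1
    funext q
    simp only [rowFun, rowMatrix, Fin.getElem_fin, List.getD_eq_getElem?_getD, List.getElem?_eq_getElem j.2,
      Option.getD_some]
  have hclt : c < 2 ^ n := by
    refine xorList_lt n _ fun x hx => ?_
    obtain ⟨e, he, rfl⟩ := List.mem_map.1 hx
    rw [(suppRows_spec (giRows Gb mt) a e he).2]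
    exact getD_lt_of_all_lt hlt (suppRows_spec (giRows Gb mt) a e he).1
  have hcB : c < 2 ^ (8 * B) := lt_of_lt_of_le hclt (Nat.pow_le_pow_right (by norm_num) hnB')
  have hpopc : popc n c ≤ wmax := by rw [← hammingNorm_ofBits, ← hsum]; exact haw
  -- it suffices that the leaf test passes on `c`
  suffices hleaf : mitmLeaf B wmax allow c = true by
    rcases mitmLeaf_imp hB31' hcB hleaf with hgt | hmem
    · rw [popc_eq_popc_of_lt hnB' hclt] at hgt
      omega
    · obtain ⟨e, he, hex⟩ : ∃ e ∈ found, e.1 = c := by simpa [hallow] using hmem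
      simp only [foundOK, List.all_eq_true, beq_iff_eq] at hfound
      rw [hsum, ← hex, ← hfound e he]
      exact ofBits_xorRows_mem_rowSpace n Hstab e.2
  have hw1 : 1 ≤ S.length := hSlen ▸ ha1
  have hwt : S.length ≤ mt.t := hSlen ▸ hat
  -- the meet-in-the-middle step for layers 4 and 5: table pair (e1, e2), probe word xp with least index m > e2.1
  have mitm_step : ∀ (e1 e2 : ℕ × ℕ) (rest : List (ℕ × ℕ)) (w : ℕ), S = e1 :: e2 :: rest → S.length = w →
      (w = 4 ∨ w = 5) → ∀ (m xp : ℕ), e2.1 < m → c = (e1.2 ^^^ e2.2) ^^^ xp →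
      (∀ g, g < wmax + 1 - w →
        probesOK B wmax allow (groupMask n mt.T (wmax + 1 - w) g) n
          (buildTabs (groupMask n mt.T (wmax + 1 - w) g) n (pairXT (idxRows (giRows Gb mt) 0)) 0 ([], 0)) (idxRows (giRows Gb mt) 0) w =
            true →
        probeOK B wmax allow (groupMask n mt.T (wmax + 1 - w) g) n
          (buildTabs (groupMask n mt.T (wmax + 1 - w) g) n (pairXT (idxRows (giRows Gb mt) 0)) 0 ([], 0)) m xp = true) →
      mitmLeaf B wmax allow c = true := by
    intro e1 e2 rest w hSe hSw hw m xp hm2 hcx hprobe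
    -- the group missed by `c`
    have hgr : groupsOK n mt.T (wmax + 1 - w) = true := by
      rcases hw with rfl | rfl
      · exact hg4
      · exact hg5
    obtain ⟨g, hg, hmiss⟩ := exists_group_miss hsysT hgr S hSspec hSnd (W := wmax) (by omega) hpopc
    have hwt' : w ≤ mt.t := hSw ▸ hwt
    obtain ⟨hT1, hP⟩ := layer_of_part (n := n) (allow := allow) (Gb := Gb) hw hg hwt' hm
    -- the table pair is recorded (T1)
    have hpair : (e1.1, e2.1, e1.2 ^^^ e2.2) ∈ pairXT (idxRows (giRows Gb mt) 0) :=
      mem_pairXT_of_sublist (hSe ▸ hSsub)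
    obtain ⟨v, hv, hvj, hvx⟩ := exists_tabFind_of_t1OK _ _ hT1 hpair
    dsimp only at hv hvj hvx
    -- the keys agree on the missed group
    have hkey : gkey (groupMask n mt.T (wmax + 1 - w) g) (e1.2 ^^^ e2.2) =
        gkey (groupMask n mt.T (wmax + 1 - w) g) xp := by
      unfold gkey
      rw [and_eq_and_of_xor_and_eq_zero (a := e1.2 ^^^ e2.2) (b := xp) (by rw [← hcx]; exact hmiss)]
    rw [hkey] at hv
    -- the probe's test on this slot value is the leaf test of `c`
    have := mitmLeaf_of_probeOK (hprobe g hg hP) hv (by rw [hvj]; exact hm2)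
    rwa [hvx, ← hcx] at this
  -- case analysis on the number of support rows (1 … 5)
  rcases hS : S with _ | ⟨e1, _ | ⟨e2, _ | ⟨e3, _ | ⟨e4, _ | ⟨e5, _ | ⟨e6, rest⟩⟩⟩⟩⟩⟩
  · rw [hS] at hw1; simp at hw1
  · -- layer 1
    have hc1 : c = e1.2 := by rw [hcdef, hS]; simp [xorList]
    rw [hc1]
    exact hd1 e1 ((hS ▸ hSsub).subset (by simp))
  · -- layer 2
    have hc2 : c = e1.2 ^^^ e2.2 := by rw [hcdef, hS]; simp [xorList]
    rw [hc2]
    have := hd2 _ (mem_pairXT_of_sublist (hS ▸ hSsub))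
    dsimp only at this
    exact this
  · -- layer 3 (direct part 1)
    have hc3 : c = e1.2 ^^^ (e2.2 ^^^ e3.2) := by rw [hcdef, hS]; simp [xorList]
    have h1 := hm 1 (by simp only [mitmParts]; omega)
    rw [mitmPart, if_neg (by omega), if_pos rfl, Bool.or_eq_true] at h1
    rcases h1 with h1 | h1
    · have := lt_of_blt h1
      rw [hS] at hwt
      simp at hwt
      omega
    · rw [hc3]
      exact direct3OK_sublist h1 (hS ▸ hSsub)
  · -- layer 4: table (e1,e2), probe pair (e3,e4)
    have h23 : e2.1 < e3.1 := by
      have := hS ▸ hSpw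
      simp only [List.pairwise_cons, List.mem_cons, forall_eq_or_imp] at this
      exact this.2.1.1
    refine mitm_step e1 e2 [e3, e4] 4 hS (by rw [hS]; rfl) (Or.inl rfl) e3.1 (e3.2 ^^^ e4.2) h23
      (by rw [hcdef, hS]; simp [xorList, Nat.xor_assoc]) fun g hg hP => ?_
    simp only [probesOK, if_true, List.all_eq_true] at hP
    have h34 : (e3 :: e4 :: []) <+ idxRows (giRows Gb mt) 0 :=
      ((List.sublist_cons_self e2 _).trans (List.sublist_cons_self e1 _)).trans (hS ▸ hSsub)
    have := hP _ (mem_pairXT_of_sublist h34)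
    dsimp only at this
    exact this
  · -- layer 5: table (e1,e2), probe (e3, pair (e4,e5))
    have h23 : e2.1 < e3.1 := by
      have := hS ▸ hSpw
      simp only [List.pairwise_cons, List.mem_cons, forall_eq_or_imp] at this
      exact this.2.1.1
    refine mitm_step e1 e2 [e3, e4, e5] 5 hS (by rw [hS]; rfl) (Or.inr rfl) e3.1 (e3.2 ^^^ (e4.2 ^^^ e5.2)) h23
      (by rw [hcdef, hS]; simp [xorList, Nat.xor_assoc]) fun g hg hP => ?_
    simp only [probesOK, show ¬ ((5 : ℕ) = 4) by omega, if_false, if_true] at hP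
    have h345 : (e3 :: e4 :: e5 :: []) <+ idxRows (giRows Gb mt) 0 :=
      ((List.sublist_cons_self e2 _).trans (List.sublist_cons_self e1 _)).trans (hS ▸ hSsub)
    exact probe5OK_sublist hP h345
  · -- six or more support rows: impossible (`|a| ≤ t ≤ 5`)
    rw [hS] at hwt
    simp at hwt
    omega

end Main

end Summit.Ventures.QEC.Census
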